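import Summits.QuantumFields.YangMills.Theorems.BalabanUVNodesN08MassesACLeastClosedFamily
import Summits.QuantumFields.YangMills.Theorems.BalabanUVNodesN08Thm2AtRecordBridgeInhabited
import Summits.QuantumFields.YangMills.Theorems.BalabanUVNodesN08TrivialHistoryIteratedTransport

/-!
# BalabanUVNodes ∕ N08 — THE HISTORY-EXTENSIVE MASS LETTER, IV: THE MEASURE CURRENCY — a HISTORY-INDEXED closed family `μ_k(h)` with `dU_0 ≤ μ_0(h)`,
# `dU_{k+1} ≤ μ_{k+1}(triv)` and `(w_k(h′)·μ_k(proj h′))∘Ū_k⁻¹ ≤ μ_{k+1}(h′)` dominates print's iterated Radon–Nikodym masses, `m_k(h,·)·dU_k ≤ μ_k(h)`; the masses' own measures ARE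
# such a family (so the criterion is exact); files 23–24's letter ⟸ `μ_k(h) ≤ exp(c_k + β·Σ_{j<k}|Z_j(h)|)·dU_k`

Track A, DAG node N08 = T. Bałaban, CMP **102** (1985) 255–275 [Balaban1985UV3]: (41) p. 266 (the history masses, «Σ_{{Ω_j}} ∫dV_{k−1}↾_{Z_{k−1}} δ(V̄_{k−1}V^{−1}) ⋯ χζ ⋯»),
(48) p. 268, (40) p. 266 (the step weights `ζχ`); [Balaban1985Averaging] (10) + (15) p. 19.  Cell `pub-ymgap`, width seat `pub-ymgap-dag-n08-w1` (g5), W-SEAT-START-LIST §n08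
item 1 successor piece (o21) = file 26; `--supports` K1⁹ `StabilityBRunRowsAtRecordR13SepCoPHV` (stmt-QuantumFields-27364, KEY MAP v2; helper).  Imports file 25 (`…N08TrivialHistoryIteratedTransport`, the exact transport).  Companion of files 16 ∕ 17
(`…N08MassesACDominated`, `…N08MassesACLeastClosedFamily`: HISTORY-BLIND closed families `ν_k`, `(dU_k + ν_k)∘Ū_k⁻¹ ≤ dU_{k+1} + ν_{k+1}`) and of files 23–25 (the history-extensive
letter and its irreducible core).

THE POINT.  Files 16∕17 reduce a.e. mass bounds to ONE closed family of measures per level, the same for every history — the currency of the UNIFORM letter.  The history-extensive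
letter of files 23–24 («`m_k(h,·) ≤ exp(c_m|T₁^{(k)}| + β·Σ_{j<k}|Z_j(h)|)`») wants a family INDEXED BY HISTORIES that follows the recursion of (41) itself: the step weight
`w_k(h′) = ζχ` (large field on `P_k(h′)`, small field on `Λ_k(h′)`, `Carriers.stepWeight`) sits INSIDE the transported measure, so a bound on `μ_{k+1}(h′)` may depend on WHERE `h′`
puts its large fields — exactly the information the Z-budget is indexed by.  This file proves the reduction in that currency and shows it is LOSSLESS.

WHAT THIS FILE PROVES (kernel; theorems only, 0 def; [folklore] measure theory over the lane's `MassesAC.massRecAC`; nothing of the paper asserted).  Any averaging family, `AvgAC`.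
* §1 `withDensity_mono_measure'` (`ν ≤ ρ ⇒ ν.withDensity g ≤ ρ.withDensity g`); `withDensity_ofReal_mul_le` (`m·dU ≤ ρ ⇒ (w·m)·dU ≤ w·ρ` for `0 ≤ w, m` measurable);
  `withDensity_rnTransport_le_of_dominated` (`f·dU ≤ ρ`, `ρ∘Ū⁻¹ ≤ ν′ ⇒ (T f)·dV ≤ ν′`, `0 ≤ f`; file 16's step with an arbitrary dominating measure); the exact transport `(T f)·dV = Ū_*(f·dU)`
  is file 25's `withDensity_rnTransport_eq_pushDensity`.
* §2 ★★★ `withDensity_massRecAC_le_of_histClosed` — **THE HISTORY-INDEXED REDUCTION**: if `μ : ∀ k, Hist P k → Measure` satisfies (i) `dU_0 ≤ μ_0(h)`, (ii) `dU_{k+1} ≤ μ_{k+1}(triv)`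
  (the floor of the (47)-term), (iii) for every ADMISSIBLE `h′` at level `k + 1`: `((μ_k(proj h′)).withDensity w_k(h′))∘Ū_k⁻¹ ≤ μ_{k+1}(h′)` (`k < K̄`), then
  **`m_k(h,·)·dU_k ≤ μ_k(h)`** for all `k ≤ K̄`, all `h` (three cases of `massRecAC` as in files 16∕17; the trivial history's `max 1 (T[…])` by file 17's `withDensity_sup_le`).
* §3 ★★ `histClosed_massRecAC` — **EXACTNESS: the masses' own measures `μ_k(h) := m_k(h,·)·dU_k` satisfy (i)–(iii)** (with EQUALITY in (i); (iii) with equality at admissible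
  non-trivial `h′` by §1's exact transport) — so §2's criterion characterises the a.e. mass bounds: nothing is lost by passing to measures.
* §4 a.e. forms: `massRecAC_le_ae_of_histClosed` (`μ_k(h) ≤ B_k(h)·dU_k ⇒ m_k(h,·) ≤ B_k(h)` a.e., `ℝ≥0∞` and real forms) and ★★★ `massRecAC_le_expZ_ae_of_histClosed` — **files 23–24's
  HISTORY-EXTENSIVE LETTER ⟸ a history-indexed closed family with `μ_k(h) ≤ exp(c_k + β·Σ_{j<k}|Z_j(h)|)·dU_k`** (`c_k, β ≥ 0`); §5 the same at print's averaging `avOfPrint N S` on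
  `SU(N)` (`massRecAC_avOfPrint_le_expZ_ae_of_histClosed`), feeding file 24 §4 `printedUV3V_at_slotOfRecord_of_alphaAC_of_massBoundZAE_of_consts(')` BY NAME.

HOW IT IS MEANT TO BE USED (located; inputs NOT supplied here).  With n08-w3's guard split (`…GuardTransport.map_add_le_closure`: off the guard `Ū = axial`, `axial_*(c·dU) = c·dV`)
and one-step fibre-volume bounds, a natural candidate is `μ_{k+1}(h′) := ((μ_k(proj h′))↾{w_k(h′) = 1})∘Ū_k⁻¹` (+ `dU_{k+1}` at `triv`): its density splits into a factor over the
history's region `Z_k(h′)` (budget `β|Z_k(h′)|`, file 23) and the reference-measure part off it ((a)′, file 25).  Nothing here decides either.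

HONEST FRAMING: count-neutral helper; no transport bound claimed; E6′ neither used nor decided; `PrintedUV3V` NOT proved; N08 NOT discharged; one finite 𝕋⁴ programme at fixed ε,
Bałaban AS PRINTED — R4 closes the conditional finite-𝕋⁴ rung `BalabanLadder.UV` only; the Yang–Mills mass gap (Clay) is NOT proved by any of this; nothing continuum ∕ ℝ⁴ ∕ OS.
No `sorry`, standard axioms.
-/

noncomputable section

open MeasureTheory
open scoped ENNReal

namespace Summit.QuantumFields.YangMills.BalabanUVNodes.N08MassesACHistoryClosedFamily

open Literature.MathematicalPhysics.QuantumFieldTheory.Balaban1983to89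
open Literature.MathematicalPhysics.QuantumFieldTheory.Balaban1983to89.AveragingRT (rnTransport rnDensity pushDensity rnTransport_nonneg)
open Summit.QuantumFields.Balaban3D.Carriers
open Summit.QuantumFields.Balaban3D.Proofs.MassesAC
open Summit.QuantumFields.Balaban3D.Proofs.Bound55Masses (measurable_stepWeight)
open Summit.QuantumFields.YangMills.BalabanUVNodes.N08MassesACDominated (rnDeriv_le_of_le_withDensity)
open Summit.QuantumFields.YangMills.BalabanUVNodes.N08MassesACLeastClosedFamily (withDensity_sup_le)
open Summit.QuantumFields.YangMills.BalabanUVNodes.N08TrivialHistoryIteratedTransport (withDensity_rnTransport_eq_pushDensity)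

/-! ## §1 Measure-theoretic steps -/
section Steps

variable {α : Type*} [MeasurableSpace α] {ν ρ : Measure α}

/-- `ν ≤ ρ ⇒ ν.withDensity g ≤ ρ.withDensity g` (setwise: `∫⁻_s g dν ≤ ∫⁻_s g dρ`). [folklore] -/
theorem withDensity_mono_measure' (h : ν ≤ ρ) (g : α → ℝ≥0∞) : ν.withDensity g ≤ ρ.withDensity g := by
  refine Measure.le_iff.2 fun s hs => ?_
  rw [withDensity_apply _ hs, withDensity_apply _ hs]
  exact lintegral_mono' (Measure.restrict_mono subset_rfl h) le_rfl

variable {P : Params} {G : Type} [GaugeGroup G] [MeasurableSpace G] [HaarData G]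

/-- **A WEIGHTED DOMINATED DENSITY IS DOMINATED BY THE WEIGHTED MEASURE**: `0 ≤ w`, `0 ≤ m` measurable and `m·dU ≤ ρ` ⇒ `(w·m)·dU ≤ w·ρ` (`withDensity_mul` + monotonicity in
the measure). [folklore] -/
theorem withDensity_ofReal_mul_le {k : ℕ} {w m : GaugeField P k G → ℝ} (hw : Measurable w) (hm : Measurable m) (hw0 : ∀ U, 0 ≤ w U)
    {ρ : Measure (GaugeField P k G)} (hdom : (fieldMeasure P k G).withDensity (fun U => ENNReal.ofReal (m U)) ≤ ρ) :
    (fieldMeasure P k G).withDensity (fun U => ENNReal.ofReal (w U * m U)) ≤ ρ.withDensity (fun U => ENNReal.ofReal (w U)) := by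
  have heq : (fun U => ENNReal.ofReal (w U * m U)) = (fun U => ENNReal.ofReal (m U)) * (fun U => ENNReal.ofReal (w U)) := by
    funext U
    simp only [Pi.mul_apply]
    rw [ENNReal.ofReal_mul (hw0 U), mul_comm]
  rw [heq, withDensity_mul _ hm.ennreal_ofReal hw.ennreal_ofReal]
  exact withDensity_mono_measure' hdom _

/-- **ONE TRANSPORT STEP WITH AN ARBITRARY DOMINATING MEASURE**: `0 ≤ f`, `f·dU ≤ ρ`, `ρ∘Ū⁻¹ ≤ ν′` (`Ū` measurable) ⇒ `(T f)·dV ≤ ν′` for the lane's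
`T = AveragingRT.rnTransport Ū` (file 16's `withDensity_rnTransport_le`, the dominating measure freed from the shape `dU + ν`). [cite: Balaban1985Averaging, (10) p.19 (the transformation; bookkeeping)] -/
theorem withDensity_rnTransport_le_of_dominated {k : ℕ} {avg : GaugeField P k G → GaugeField P (k + 1) G} (havg : Measurable avg)
    {f : GaugeField P k G → ℝ} (hf0 : ∀ U, 0 ≤ f U) {ρ : Measure (GaugeField P k G)} {ν' : Measure (GaugeField P (k + 1) G)}
    (hdom : (fieldMeasure P k G).withDensity (fun U => ENNReal.ofReal (f U)) ≤ ρ) (hstep : ρ.map avg ≤ ν') :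
    (fieldMeasure P (k + 1) G).withDensity (fun V => ENNReal.ofReal (rnTransport avg f V)) ≤ ν' := by
  have hpush : pushDensity avg f ≤ ν' := by
    unfold pushDensity
    exact (Measure.map_mono hdom havg).trans hstep
  have hT : ∀ V, ENNReal.ofReal (rnTransport avg f V) ≤ (pushDensity avg f).rnDeriv (fieldMeasure P (k + 1) G) V := by
    intro V
    have : rnTransport avg f V = rnDensity avg f V := by simp only [rnTransport, if_pos hf0]
    rw [this]
    exact ENNReal.ofReal_toReal_le
  calc (fieldMeasure P (k + 1) G).withDensity (fun V => ENNReal.ofReal (rnTransport avg f V))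
      ≤ (fieldMeasure P (k + 1) G).withDensity ((pushDensity avg f).rnDeriv (fieldMeasure P (k + 1) G)) := withDensity_mono (Filter.Eventually.of_forall hT)
    _ ≤ pushDensity avg f := Measure.withDensity_rnDeriv_le _ _
    _ ≤ ν' := hpush

end Steps

/-! ## §2 The history-indexed reduction -/
section HistClosed

variable {P : Params} {G : Type} [GaugeGroup G] [MeasurableSpace G] [HaarData G] [RegularGaugeGroup G]
  (M₁ : ℕ) (Rcol : ℕ → ℕ) (εL εS : ℕ → ℝ) (av : ∀ j, Averaging P j G) (hav : ∀ j, AvgAC (av j).avg)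
include hav

open Classical in
/-- ★★★ **THE ITERATED AC MASSES UNDER A HISTORY-INDEXED CLOSED FAMILY**: let `μ_k(h)` be measures on the level-`k` fields with (i) `dU_0 ≤ μ_0(h)`, (ii) `dU_{k+1} ≤ μ_{k+1}(triv)`
for `k < K̄` (the floor of the (47)-term), (iii) for `k < K̄` and every ADMISSIBLE history `h′` at level `k + 1`, `((μ_k(proj h′)).withDensity w_k(h′))∘Ū_k⁻¹ ≤ μ_{k+1}(h′)` —
the step weight `w_k(h′) = ζχ` of (40) INSIDE the transported measure.  Then **`m_k(h,·)·dU_k ≤ μ_k(h)`** for every `k ≤ K̄` and every history `h`.  Induction over the three cases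
of `MassesAC.massRecAC`: inadmissible `0`; admissible non-trivial = the exact transport of `w_k(h′)·m_k(proj h′)` (§1's step with `ρ = w_k(h′)·μ_k(proj h′)`); trivial =
`max 1 (T_k[…])`, the supremum of `1` and the transport, both dominated (file 17's `withDensity_sup_le`).  Only the measurability of `Ū` is used
(and `[RegularGaugeGroup G]`, for the measurability of the step weights). [cite: Balaban1985UV3, (41) p.266 + (48) p.268 + (40) p.266 (the masses; bookkeeping); Balaban1985Averaging, (10) p.19] -/
theorem withDensity_massRecAC_le_of_histClosed (Kt : ℕ) (μ : ∀ k, Hist P k → Measure (GaugeField P k G))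
    (h0 : ∀ h : Hist P 0, fieldMeasure P 0 G ≤ μ 0 h)
    (hfloor : ∀ k, k < Kt → fieldMeasure P (k + 1) G ≤ μ (k + 1) (Hist.triv P (k + 1)))
    (hstep : ∀ k, k < Kt → ∀ h' : Hist P (k + 1), Hist.Admissible M₁ Rcol (k + 1) h' →
      ((μ k h'.proj).withDensity (fun U => ENNReal.ofReal (stepWeight M₁ Rcol εL εS k h' U))).map (av k).avg ≤ μ (k + 1) h') :
    ∀ k, k ≤ Kt → ∀ h : Hist P k,
      (fieldMeasure P k G).withDensity (fun V => ENNReal.ofReal (massRecAC M₁ Rcol εL εS av k h V)) ≤ μ k h := by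
  intro k
  induction k with
  | zero =>
    intro _ h
    have h1 : (fun V => ENNReal.ofReal (massRecAC M₁ Rcol εL εS av 0 h V)) = fun _ => (1 : ℝ≥0∞) := by
      funext V; rw [massRecAC_zero]; simp
    rw [h1, withDensity_const, one_smul]
    exact h0 h
  | succ k ih =>
    intro hk h
    by_cases hh : Hist.Admissible M₁ Rcol (k + 1) h
    · -- the integrand of the step and its weighted domination
      have hf0 : ∀ U, 0 ≤ stepWeight M₁ Rcol εL εS k h U * massRecAC M₁ Rcol εL εS av k h.proj U := fun U =>
        mul_nonneg (stepWeight_nonneg M₁ Rcol εL εS k h U) (massRecAC_nonneg M₁ Rcol εL εS av k _ U)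
      have hdom := withDensity_ofReal_mul_le (measurable_stepWeight M₁ Rcol εL εS k h) (measurable_massRecAC M₁ Rcol εL εS av k h.proj)
        (stepWeight_nonneg M₁ Rcol εL εS k h) (ih (by omega) h.proj)
      have hT := withDensity_rnTransport_le_of_dominated (hav k).1 hf0 hdom (hstep k (by omega) h hh)
      by_cases ht : h = Hist.triv P (k + 1)
      · -- trivial history: `max 1 (T[…])` = `1 ⊔ T[…]`, both dominated by `μ_{k+1}(triv)`
        subst ht
        have heq : (fun V => ENNReal.ofReal (massRecAC M₁ Rcol εL εS av (k + 1) (Hist.triv P (k + 1)) V)) = fun V =>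
            max ((fun _ => (1 : ℝ≥0∞)) V) (ENNReal.ofReal (rnTransport (av k).avg
              (fun U => stepWeight M₁ Rcol εL εS k (Hist.triv P (k + 1)) U * massRecAC M₁ Rcol εL εS av k (Hist.triv P (k + 1)).proj U) V)) := by
          funext V
          rw [massRecAC_triv_succ, Hist.proj_triv, ENNReal.ofReal_max, ENNReal.ofReal_one]
        rw [heq]
        refine withDensity_sup_le measurable_const (measurable_rnTransport _ _).ennreal_ofReal ?_ hT
        rw [withDensity_const, one_smul]
        exact hfloor k (by omega)
      · -- admissible non-trivial: the exact transport
        have heq : (fun V => ENNReal.ofReal (massRecAC M₁ Rcol εL εS av (k + 1) h V)) = fun V => ENNReal.ofReal (rnTransport (av k).avg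
            (fun U => stepWeight M₁ Rcol εL εS k h U * massRecAC M₁ Rcol εL εS av k h.proj U) V) := by
          funext V; rw [massRecAC_succ M₁ Rcol εL εS av k h hh ht V]
        rw [heq]
        exact hT
    · -- inadmissible: mass `0`
      have heq : (fun V => ENNReal.ofReal (massRecAC M₁ Rcol εL εS av (k + 1) h V)) = fun _ => (0 : ℝ≥0∞) := by
        funext V; rw [massRecAC_eq_zero_of_not_admissible M₁ Rcol εL εS av (k + 1) h V hh]; simp
      rw [heq, withDensity_const, zero_smul]
      exact bot_le

/-! ## §3 The a.e. forms and the history-extensive corollary -/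

/-- ★ **a.e. FORM**: under (i)–(iii), if `μ_k(h) ≤ dU_k.withDensity B_k(h)` then `m_k(h,·) ≤ B_k(h)` `dU_k`-a.e. (in `ℝ≥0∞`), `k ≤ K̄`. [cite: Balaban1985UV3, (41) p.266 (the masses; bookkeeping)] -/
theorem massRecAC_le_ae_of_histClosed (Kt : ℕ) (μ : ∀ k, Hist P k → Measure (GaugeField P k G))
    (h0 : ∀ h : Hist P 0, fieldMeasure P 0 G ≤ μ 0 h)
    (hfloor : ∀ k, k < Kt → fieldMeasure P (k + 1) G ≤ μ (k + 1) (Hist.triv P (k + 1)))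
    (hstep : ∀ k, k < Kt → ∀ h' : Hist P (k + 1), Hist.Admissible M₁ Rcol (k + 1) h' →
      ((μ k h'.proj).withDensity (fun U => ENNReal.ofReal (stepWeight M₁ Rcol εL εS k h' U))).map (av k).avg ≤ μ (k + 1) h')
    (B : ∀ k, Hist P k → GaugeField P k G → ℝ≥0∞) (hμB : ∀ k, k ≤ Kt → ∀ h, μ k h ≤ (fieldMeasure P k G).withDensity (B k h))
    (k : ℕ) (hk : k ≤ Kt) (h : Hist P k) :
    ∀ᵐ V ∂(fieldMeasure P k G), ENNReal.ofReal (massRecAC M₁ Rcol εL εS av k h V) ≤ B k h V := by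
  have hmeas : Measurable fun V => ENNReal.ofReal (massRecAC M₁ Rcol εL εS av k h V) :=
    (measurable_massRecAC M₁ Rcol εL εS av k h).ennreal_ofReal
  have hle : (fieldMeasure P k G).withDensity (fun V => ENNReal.ofReal (massRecAC M₁ Rcol εL εS av k h V)) ≤ (fieldMeasure P k G).withDensity (B k h) :=
    (withDensity_massRecAC_le_of_histClosed M₁ Rcol εL εS av hav Kt μ h0 hfloor hstep k hk h).trans (hμB k hk h)
  have h1 := rnDeriv_le_of_le_withDensity hle
  have h2 := Measure.rnDeriv_withDensity (fieldMeasure P k G) hmeas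
  filter_upwards [h1, h2] with V hV1 hV2
  rw [← hV2]
  exact hV1

/-- **… real form**: with `0 ≤ b_k(h)` real and `μ_k(h) ≤ dU_k.withDensity (ofReal ∘ b_k(h))`, `m_k(h,V) ≤ b_k(h)(V)` for `dU_k`-a.e. `V`. [folklore] -/
theorem massRecAC_le_ae_of_histClosed_real (Kt : ℕ) (μ : ∀ k, Hist P k → Measure (GaugeField P k G))
    (h0 : ∀ h : Hist P 0, fieldMeasure P 0 G ≤ μ 0 h)
    (hfloor : ∀ k, k < Kt → fieldMeasure P (k + 1) G ≤ μ (k + 1) (Hist.triv P (k + 1)))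
    (hstep : ∀ k, k < Kt → ∀ h' : Hist P (k + 1), Hist.Admissible M₁ Rcol (k + 1) h' →
      ((μ k h'.proj).withDensity (fun U => ENNReal.ofReal (stepWeight M₁ Rcol εL εS k h' U))).map (av k).avg ≤ μ (k + 1) h')
    (b : ∀ k, Hist P k → GaugeField P k G → ℝ) (hb0 : ∀ k h V, 0 ≤ b k h V)
    (hμb : ∀ k, k ≤ Kt → ∀ h, μ k h ≤ (fieldMeasure P k G).withDensity (fun V => ENNReal.ofReal (b k h V)))
    (k : ℕ) (hk : k ≤ Kt) (h : Hist P k) :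
    ∀ᵐ V ∂(fieldMeasure P k G), massRecAC M₁ Rcol εL εS av k h V ≤ b k h V := by
  filter_upwards [massRecAC_le_ae_of_histClosed M₁ Rcol εL εS av hav Kt μ h0 hfloor hstep (fun k h V => ENNReal.ofReal (b k h V)) hμb k hk h]
    with V hV
  exact (ENNReal.ofReal_le_ofReal_iff (hb0 k h V)).1 hV

/-- ★★★ **FILES 23–24's HISTORY-EXTENSIVE LETTER FROM A HISTORY-INDEXED CLOSED FAMILY**: under (i)–(iii), if
`μ_k(h) ≤ exp(c_k + β·Σ_{j<k}|Z_j(h)|)·dU_k` (`k ≤ K̄`; at the [B10] slot `c_k = c_m|T₁^{(k)}|`, `β = d(𝔤)c₁`), then `m_k(h,V) ≤ exp(c_k + β·Σ_{j<k}|Z_j(h)|)` for `dU_k`-a.e. `V` —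
the antecedent of file 24 §4 `printedUV3V_at_slotOfRecord_of_alphaAC_of_massBoundZAE_of_consts`. [cite: Balaban1985UV3, (41) p.266 + (5) p.257 (the extensive shape)] -/
theorem massRecAC_le_expZ_ae_of_histClosed (Kt : ℕ) (μ : ∀ k, Hist P k → Measure (GaugeField P k G))
    (h0 : ∀ h : Hist P 0, fieldMeasure P 0 G ≤ μ 0 h)
    (hfloor : ∀ k, k < Kt → fieldMeasure P (k + 1) G ≤ μ (k + 1) (Hist.triv P (k + 1)))
    (hstep : ∀ k, k < Kt → ∀ h' : Hist P (k + 1), Hist.Admissible M₁ Rcol (k + 1) h' →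
      ((μ k h'.proj).withDensity (fun U => ENNReal.ofReal (stepWeight M₁ Rcol εL εS k h' U))).map (av k).avg ≤ μ (k + 1) h')
    (c : ℕ → ℝ) (β : ℝ)
    (hμ : ∀ k, k ≤ Kt → ∀ h : Hist P k,
      μ k h ≤ ENNReal.ofReal (Real.exp (c k + β * ∑ j ∈ Finset.range k, (ZVol M₁ Rcol k h j : ℝ))) • fieldMeasure P k G)
    (k : ℕ) (hk : k ≤ Kt) (h : Hist P k) :
    ∀ᵐ V ∂(fieldMeasure P k G), massRecAC M₁ Rcol εL εS av k h V ≤ Real.exp (c k + β * ∑ j ∈ Finset.range k, (ZVol M₁ Rcol k h j : ℝ)) :=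
  massRecAC_le_ae_of_histClosed_real M₁ Rcol εL εS av hav Kt μ h0 hfloor hstep
    (fun k h _ => Real.exp (c k + β * ∑ j ∈ Finset.range k, (ZVol M₁ Rcol k h j : ℝ))) (fun _ _ _ => (Real.exp_pos _).le)
    (fun k hk h => by rw [withDensity_const]; exact hμ k hk h) k hk h

/-! ## §4 Exactness: the masses' own measures are a history-indexed closed family -/

open Classical in
/-- ★★ **EXACTNESS — THE MASSES THEMSELVES SATISFY (i)–(iii)**: with `μ_k(h) := m_k(h,·)·dU_k`: (i) `dU_0 = μ_0(h)`; (ii) `dU_{k+1} ≤ μ_{k+1}(triv)` (the floor `m(triv) ≥ 1`);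
(iii) for admissible `h′`, `((μ_k(proj h′)).withDensity w_k(h′))∘Ū_k⁻¹ ≤ μ_{k+1}(h′)` — with EQUALITY at non-trivial `h′` (`(T f)·dV = Ū_*(f·dU)`, §1) and `≤ max 1 (…)` at `triv`.
So §2's criterion is a characterisation: an a.e. bound `m_k(h,·) ≤ B_k(h)` holds iff SOME history-indexed closed family has `μ_k(h) ≤ B_k(h)·dU_k`. [cite: Balaban1985UV3, (41) p.266 + (48) p.268 (the masses; bookkeeping); Balaban1985Averaging, (10) p.19] -/
theorem histClosed_massRecAC :
    (∀ h : Hist P 0, fieldMeasure P 0 G ≤ (fieldMeasure P 0 G).withDensity (fun V => ENNReal.ofReal (massRecAC M₁ Rcol εL εS av 0 h V))) ∧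
    (∀ k, fieldMeasure P (k + 1) G ≤
      (fieldMeasure P (k + 1) G).withDensity (fun V => ENNReal.ofReal (massRecAC M₁ Rcol εL εS av (k + 1) (Hist.triv P (k + 1)) V))) ∧
    (∀ k (h' : Hist P (k + 1)), Hist.Admissible M₁ Rcol (k + 1) h' →
      (((fieldMeasure P k G).withDensity (fun U => ENNReal.ofReal (massRecAC M₁ Rcol εL εS av k h'.proj U))).withDensity
          (fun U => ENNReal.ofReal (stepWeight M₁ Rcol εL εS k h' U))).map (av k).avg ≤
        (fieldMeasure P (k + 1) G).withDensity (fun V => ENNReal.ofReal (massRecAC M₁ Rcol εL εS av (k + 1) h' V))) := by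
  refine ⟨fun h => ?_, fun k => ?_, fun k h' hh => ?_⟩
  · have h1 : (fun V => ENNReal.ofReal (massRecAC M₁ Rcol εL εS av 0 h V)) = fun _ => (1 : ℝ≥0∞) := by
      funext V; rw [massRecAC_zero]; simp
    rw [h1, withDensity_const, one_smul]
  · calc fieldMeasure P (k + 1) G = (fieldMeasure P (k + 1) G).withDensity (fun _ => (1 : ℝ≥0∞)) := by rw [withDensity_const, one_smul]
      _ ≤ _ := withDensity_mono (Filter.Eventually.of_forall fun V => by
          rw [← ENNReal.ofReal_one]
          exact ENNReal.ofReal_le_ofReal (one_le_massRecAC_triv M₁ Rcol εL εS av (k + 1) V))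
  · -- the weighted measure IS `(w·m_k(proj h′))·dU`, whose exact transport is `T_k[w·m_k(proj h′)]·dV`
    have hf0 : ∀ U, 0 ≤ stepWeight M₁ Rcol εL εS k h' U * massRecAC M₁ Rcol εL εS av k h'.proj U := fun U =>
      mul_nonneg (stepWeight_nonneg M₁ Rcol εL εS k h' U) (massRecAC_nonneg M₁ Rcol εL εS av k _ U)
    have hprod : ((fieldMeasure P k G).withDensity (fun U => ENNReal.ofReal (massRecAC M₁ Rcol εL εS av k h'.proj U))).withDensity
          (fun U => ENNReal.ofReal (stepWeight M₁ Rcol εL εS k h' U)) =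
        (fieldMeasure P k G).withDensity (fun U => ENNReal.ofReal (stepWeight M₁ Rcol εL εS k h' U * massRecAC M₁ Rcol εL εS av k h'.proj U)) := by
      rw [← withDensity_mul _ (measurable_massRecAC M₁ Rcol εL εS av k h'.proj).ennreal_ofReal (measurable_stepWeight M₁ Rcol εL εS k h').ennreal_ofReal]
      refine withDensity_congr_ae (Filter.Eventually.of_forall fun U => ?_)
      simp only [Pi.mul_apply]
      rw [ENNReal.ofReal_mul (stepWeight_nonneg M₁ Rcol εL εS k h' U), mul_comm]
    have hexact := withDensity_rnTransport_eq_pushDensity (hav k) hf0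
      (integrable_stepWeight_mul M₁ Rcol εL εS k h' (integrable_massRecAC M₁ Rcol εL εS av k h'.proj))
    rw [hprod]
    show pushDensity (av k).avg (fun U => stepWeight M₁ Rcol εL εS k h' U * massRecAC M₁ Rcol εL εS av k h'.proj U) ≤ _
    rw [← hexact]
    refine withDensity_mono (Filter.Eventually.of_forall fun V => ENNReal.ofReal_le_ofReal ?_)
    by_cases ht : h' = Hist.triv P (k + 1)
    · subst ht
      rw [massRecAC_triv_succ, Hist.proj_triv]
      exact le_max_right _ _
    · rw [massRecAC_succ M₁ Rcol εL εS av k h' hh ht V]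


end HistClosed

/-! ## §5 At the [B10] slot's averaging -/
section Print

open Literature.MathematicalPhysics.QuantumFieldTheory.Balaban1985CMP102.Setting (Scales)
open Literature.MathematicalPhysics.QuantumFieldTheory.Balaban1983to89.B10RunsOfRecord (avOfPrint)
open Literature.MathematicalPhysics.QuantumFieldTheory.Balaban1983to89.Node00 (SU)
open Summit.QuantumFields.YangMills.BalabanUVNodes.N08Thm2AtRecordBridgeInhabited (avgAC_avOfPrint)

variable (N : ℕ) [NeZero N] {L : ℕ} (S : Scales L) (M₁ : ℕ) (Rcol : ℕ → ℕ) (εL εS : ℕ → ℝ)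

/-- ★★★ **AT PRINT'S AVERAGING**: a history-indexed family closed under the weighted steps of [Balaban1985Averaging] (15) on `SU(N)` up to level `K` with
`μ_k(h) ≤ exp(c_m|T₁^{(k)}| + β·Σ_{j<k}|Z_j(h)|)·dU_k` gives «`massRecAC M₁ Rcol ε_L ε_S (avOfPrint N S) k h ≤ exp(c_m|T₁^{(k)}| + β·Σ_{j<k}|Z_j(h)|)` `dU_k`-a.e.», every `k ≤ K`,
every history — file 24 §4's antecedent at one family member (`β = d(𝔤)c₁` there). [cite: Balaban1985UV3, (41) p.266 + (5) p.257; Balaban1985Averaging, (15) p.19] -/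
theorem massRecAC_avOfPrint_le_expZ_ae_of_histClosed (μ : ∀ k, Hist S.P k → Measure (GaugeField S.P k (SU N)))
    (h0 : ∀ h : Hist S.P 0, fieldMeasure S.P 0 (SU N) ≤ μ 0 h)
    (hfloor : ∀ k, k < S.K → fieldMeasure S.P (k + 1) (SU N) ≤ μ (k + 1) (Hist.triv S.P (k + 1)))
    (hstep : ∀ k, k < S.K → ∀ h' : Hist S.P (k + 1), Hist.Admissible M₁ Rcol (k + 1) h' →
      ((μ k h'.proj).withDensity (fun U => ENNReal.ofReal (stepWeight M₁ Rcol εL εS k h' U))).map (avOfPrint N S k).avg ≤ μ (k + 1) h')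
    (cm β : ℝ)
    (hμ : ∀ k, k ≤ S.K → ∀ h : Hist S.P k,
      μ k h ≤ ENNReal.ofReal (Real.exp (cm * S.sites k + β * ∑ j ∈ Finset.range k, (ZVol M₁ Rcol k h j : ℝ))) • fieldMeasure S.P k (SU N))
    (k : ℕ) (hk : k ≤ S.K) (h : Hist S.P k) :
    ∀ᵐ V ∂(fieldMeasure S.P k (SU N)), massRecAC M₁ Rcol εL εS (avOfPrint N S) k h V ≤
      Real.exp (cm * S.sites k + β * ∑ j ∈ Finset.range k, (ZVol M₁ Rcol k h j : ℝ)) :=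
  massRecAC_le_expZ_ae_of_histClosed M₁ Rcol εL εS (avOfPrint N S) (avgAC_avOfPrint N L S) S.K μ h0 hfloor hstep (fun k => cm * S.sites k) β hμ k hk h

end Print

end Summit.QuantumFields.YangMills.BalabanUVNodes.N08MassesACHistoryClosedFamily

end
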